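/-
Copyright (c) 2026 the pub-hodgecm-mathlib formalisation cell (harness21).  Prover seat hodgecm-mathlib-K2E2-p12 (g9), Track B «K2-LIT», h413 = `stmt-HodgeConjecture-24833`,
R90-TF section S8 «ContSpec-n½» (S8 dealer R90-CS-plan (g3); default (n3) after the (V) table's POLE-LEDGER row): the DECAY-FREE editions of the section-generic Maass–Selberg DIAGONAL
and POLE-CONTROL heads of `U(2,1)_{L∕L⁺}` — ★ (R6g-b∕c) `maassSelberg_diagonal_flatSectionU_cm_three`, ★ `integral_normSq_truncation_eq_cm_three`, ★ `poleControl_diag_flatSectionU_cm_three`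
(K2E4-p10) and the capstone ★ `poleControl_flatSectionU_cm_three_final` (IV.3.12 (a)'s analytic core) — with `hdec`, `hdec′`, `hdecU` discharged by domination.
-/
import Summits.HodgeConjecture.HodgeConjecture.Theorems.K2E1MaassSelbergPoleControlCMThreeFinal      -- ★ the capstone and its ★ inputs (PoleControlCMThree, DiagonalCMThree, (R6g-a∕c), CM-FINAL′)
import Summits.HodgeConjecture.HodgeConjecture.Theorems.K2E1ChiEisensteinPairTruncationTubeCMThree    -- ★ (α′) (R90-C133-p02): `exists_norm_truncation_le_level_cm_three_uniform`; brings ★ p863443 `hMfU_level_cm_three`, ★ p863150 ED. 3 `maassSelberg_flatSectionU_cm_three_final_free`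
import HarnessLib

/-!
# h413 ∕ Track B «K2-LIT» ∕ R90-S8 — `K2E1MaassSelbergPoleControlFreeCMThree`: THE MAASS–SELBERG DIAGONAL NORM FORMULA AND THE POLE CONTROL ON THE GODEMENT HALF-PLANE FOR FLAT
# SECTIONS OF `U(2,1)_{L∕L⁺}`, WITHOUT ANY DECAY LETTER (free editions of ★ R6g-b∕c, ★ R6h and the ★ capstone)

Cell `pub/hodgecm-mathlib`, crux H413 = `stmt-HodgeConjecture-24833`, route `HCCMUnconditional`; R90-TF section S8, the χ POLE-LEDGER row of the (V) discharge table
(`R90/S8/CENSUS-V-DischargeTable.K2E2-p12-g9.md`, 3df908fcf11ad296): its CONVERGENT-HALF-PLANE half.  THEOREMS ONLY (no `def`, no `instance`, no notation, no named-fact hypothesis, no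
`sorry`; default heartbeats); lane `--supports stmt-HodgeConjecture-24833 --as helper` (count-neutral).  Closes no socket.

WHAT CHANGES ([MoeglinWaldspurger1995, IV.2.3, IV.3.8, IV.3.12 (a)]; [Arthur1980TraceFormulaII, §4]).  The ★ section-generic chain (φ continuous, bounded, left-`N(𝔸)`∕`B(L⁺)`-invariant;
`Re z > 2`) names exactly two analytic letters: `hdec′` (the decay of `E(f_{z′}) − E(f_{z′})_B` pointwise on the sub-tube — consumed ONLY by ★ CM-FINAL′ to bound `Λ^T E(f_{z′})`) and
`hdec`∕`hdecU` (the same decay z′-uniformly near `z` — consumed ONLY by ★ (R6g-a) to get one sup bound of `Λ^T E(φ, z′)` on a ball around `z`, for the dominated-convergence step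
`z′ → z`).  Both bounds are FREE by DOMINATION: ★ ED. 3 `maassSelberg_flatSectionU_cm_three_final_free` (p863150) and ★ (α′) `exists_norm_truncation_le_level_cm_three_uniform` ∘ ★
`hMfU_level_cm_three` (p863443).  So the four heads lose their decay letters; the price is two harmless structural binders (`h𝓕c` — `𝓕` of compact closure — and the
left-`N(𝔸)`-invariance `hφN`, both already present in every consumer).  Statements are otherwise BYTE-IDENTICAL to the ★ ones; proofs = the ★ bodies (K2E4-p10's) with the two
substitutions.
* §1 **`maassSelberg_diagonal_flatSectionU_cm_three_free`** — `∫_X ‖Λ^T E(φ,z)‖² dμ = R(z)` from `hrel` on the sub-tube, `hR`, `hcont` (no `hdec`).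
* §2 **`integral_normSq_truncation_eq_cm_three_free`** (`hcont` by ★ (R6g-c)), **`poleControl_diag_flatSectionU_cm_three_free`** (★ R6h-a algebra).
* §3 **`poleControl_flatSectionU_cm_three_final_free`** — THE CAPSTONE, FREE: named inputs = the `K_U`-average data `Ξ₁, Ξ₂(·), Ξ₃, Ξ₄(·)`, the bracket continuity `hB₂ hB₄`, the
  diagonal identification — NOTHING analytic about `E − E_B`.  For `(χ₁, χ₂)`-pair sections ★ p863103 `xi_package_cross` + ★ p863279∕p863423 supply the `Ξ`-package.
HONEST LABEL: HC_CM is proved only modulo the 7 printed citations (2 remaining named inputs: hLiu418 = `stmt-HodgeConjecture-24832`, h413 = `stmt-HodgeConjecture-24833`) until rung 0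
closes; this file asserts no named fact and closes no socket; it is the `{Re > 2}` half of the pole ledger only — the continuation across `Re = 2` (R7∕R8) is NOT claimed; count-neutral;
authorship of the mathematics: K2E4-p10 (★ R6g∕R6h∕capstone) — this seat only removes the letters.

## References
* [MoeglinWaldspurger1995] C. Mœglin, J.-L. Waldspurger, *Spectral decomposition and Eisenstein series* (1995), IV.2.3, IV.3.8, IV.3.12.
* [Arthur1980TraceFormulaII] J. Arthur, *A trace formula for reductive groups II*, Compositio Math. 40 (1980), §4.
* [Garrett2018] P. Garrett, *Modern Analysis of Automorphic Forms by Example* (2018), §1.12, §11.3.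
-/

set_option autoImplicit false
set_option linter.dupNamespace false  -- the mandated namespace repeats the summit's segment (`HodgeConjecture.HodgeConjecture`)

noncomputable section

open MeasureTheory Measure NumberField IsDedekindDomain Set Filter Topology MulAction Metric
open scoped ENNReal NNReal ComplexConjugate
open Literature.MeasureTheory.Group Literature.NumberTheory
open Literature.NumberTheory.Automorphic Literature.NumberTheory.Automorphic.UnitaryGroup AdelicGroupData
open Summit.HodgeConjecture.HodgeConjecture.Cruxes.H413.K2E1BorelEisensteinU
open Summit.HodgeConjecture.HodgeConjecture.Cruxes.H413.K2E1TruncatedEisensteinL2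
open Summit.HodgeConjecture.HodgeConjecture.Cruxes.H413.K2E1TruncatedEisensteinBoundedCMThree
open Summit.HodgeConjecture.HodgeConjecture.Cruxes.H413.K2E1TruncatedEisensteinLocallyUniformCMThree
open Summit.HodgeConjecture.HodgeConjecture.Cruxes.H413.K2E1MaassSelbergSymmetry
open Summit.HodgeConjecture.HodgeConjecture.Cruxes.H413.K2E1MaassSelbergPoleInequality
open Summit.HodgeConjecture.HodgeConjecture.Cruxes.H413.K2E1MaassSelbergDiagonalCMThree
open Summit.HodgeConjecture.HodgeConjecture.Cruxes.H413.K2E1TruncatedEisensteinContinuousCMThree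
open Summit.HodgeConjecture.HodgeConjecture.Cruxes.H413.K2E1MaassSelbergPoleControlCMThree
open Summit.HodgeConjecture.HodgeConjecture.Cruxes.H413.K2E1MaassSelbergPoleControlCMThreeFinal (continuousWithinAt_fourTerm)
open Summit.HodgeConjecture.HodgeConjecture.Cruxes.H413.K2E1ChiTruncatedEisensteinBoundedCMThree (maassSelberg_flatSectionU_cm_three_final_free)
open Summit.HodgeConjecture.HodgeConjecture.Cruxes.H413.K2E1ChiEisensteinPairTruncationTubeCMThree (exists_norm_truncation_le_level_cm_three_uniform)
open Summit.HodgeConjecture.HodgeConjecture.Cruxes.H413.K2E1EisensteinConstantTermIntertwinedBoundUniformU3 (hMfU_level_cm_three)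
open Summit.HodgeConjecture.HodgeConjecture.Cruxes.H413.K2E1BorelCosetsDictionary (forall_arithmeticBorel_iff)

namespace Summit.HodgeConjecture.HodgeConjecture.Cruxes.H413.K2E1MaassSelbergPoleControlFreeCMThree

variable (L : Type) [Field L] [NumberField L] [IsCMField L]
variable [MeasurableSpace (quasiSplit (↥(maximalRealSubfield L)) L (IsCMField.complexConj L) 3).Adelic] [BorelSpace (quasiSplit (↥(maximalRealSubfield L)) L (IsCMField.complexConj L) 3).Adelic]

/-- **THE MAASS–SELBERG NORM FORMULA ON THE DIAGONAL, FREE EDITION** (★ `maassSelberg_diagonal_flatSectionU_cm_three` with its ONE analytic letter `hdec` — the z′-uniform decay of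
`E(f) − E(f)_B` near `z` — DISCHARGED): ★ (R6g-b) used `hdec` only through ★ (R6g-a) to get ONE sup bound of `Λ^T E(φ, z′)` on a ball around `z`; that bound is FREE for every
continuous bounded left-`N(𝔸)`∕`B(L⁺)`-invariant section (★ (α′) `exists_norm_truncation_le_level_cm_three_uniform` ∘ ★ `hMfU_level_cm_three`, domination + Gindikin–Karpelevich).  New
binders: `h𝓕c` (compact closure of `𝓕`) and `hφN` (left-`N(𝔸)`-invariance); removed: `hV`, `hdec`.  Conclusion verbatim: `∫_X ‖Λ^T E(φ,z)‖² dμ = R(z)`.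
[cite: Arthur1980TraceFormulaII, §4] [cite: MoeglinWaldspurger1995, IV.2.3 and IV.3.8] [cite: Garrett2018, §11.3] -/
theorem maassSelberg_diagonal_flatSectionU_cm_three_free
    (ν : Measure (adelicUnipotent (↥(maximalRealSubfield L)) L (IsCMField.complexConj L) 3)) [ν.IsHaarMeasure]
    {𝓕 : Set (adelicUnipotent (↥(maximalRealSubfield L)) L (IsCMField.complexConj L) 3)}
    (h𝓕 : IsFundamentalDomain (rationalUnipotent (↥(maximalRealSubfield L)) L (IsCMField.complexConj L) 3) 𝓕 ν) (h𝓕c : IsCompact (closure 𝓕)) {T : ℝ≥0} (hT : 1 ≤ T)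
    {z : ℂ} (hz : 2 < z.re)
    {φ : (quasiSplit (↥(maximalRealSubfield L)) L (IsCMField.complexConj L) 3).Adelic → ℂ} (hφc : Continuous φ) {M : ℝ} (hφM : ∀ x, ‖φ x‖ ≤ M)
    (hφB : ∀ b ∈ borelU ((IsCMField.complexConj L : L ≃ₐ[↥(maximalRealSubfield L)] L) : L →+* L) ((StdForm.antidiagonal 3).over L),
      ∀ x : (quasiSplit (↥(maximalRealSubfield L)) L (IsCMField.complexConj L) 3).Adelic,
        φ ((quasiSplit (↥(maximalRealSubfield L)) L (IsCMField.complexConj L) 3).toAdelic b * x) = φ x)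
    (hφN : ∀ (u : ↥(adelicUnipotent (↥(maximalRealSubfield L)) L (IsCMField.complexConj L) 3)) (x : (quasiSplit (↥(maximalRealSubfield L)) L (IsCMField.complexConj L) 3).Adelic), φ ((u : (quasiSplit (↥(maximalRealSubfield L)) L (IsCMField.complexConj L) 3).Adelic) * x) = φ x)
    (μ : Measure (quasiSplit (↥(maximalRealSubfield L)) L (IsCMField.complexConj L) 3).automorphicQuotient) [IsFiniteMeasure μ]
    -- NAMED: pointwise continuity of the truncation in `z′` from inside the sub-tube (brick (R6g-c))
    (hcont : ∀ g : (quasiSplit (↥(maximalRealSubfield L)) L (IsCMField.complexConj L) 3).Adelic,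
      ContinuousWithinAt (fun z' : ℂ => truncation ν 𝓕 T (eisensteinSeriesU (flatSectionU φ z')) g) {z' : ℂ | 2 < z'.re ∧ z'.re < z.re} z)
    -- the relation of record on the sub-tube and its right-hand side
    {R : ℂ → ℂ} (hR : ContinuousWithinAt R {z' : ℂ | 2 < z'.re ∧ z'.re < z.re} z)
    (hrel : ∀ z' : ℂ, 2 < z'.re → z'.re < z.re →
      ∫ x, (quasiSplit (↥(maximalRealSubfield L)) L (IsCMField.complexConj L) 3).quotFun (truncation ν 𝓕 T (eisensteinSeriesU (flatSectionU φ z))) x *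
          conj ((quasiSplit (↥(maximalRealSubfield L)) L (IsCMField.complexConj L) 3).quotFun (truncation ν 𝓕 T (eisensteinSeriesU (flatSectionU φ z'))) x) ∂μ = R z') :
    ((∫ x, ‖(quasiSplit (↥(maximalRealSubfield L)) L (IsCMField.complexConj L) 3).quotFun (truncation ν 𝓕 T (eisensteinSeriesU (flatSectionU φ z))) x‖ ^ 2 ∂μ : ℝ) : ℂ) = R z := by
  -- a compact ball `closedBall z r ⊆ {Re > 2}` around `z` carrying ONE sup bound — FREE (★ (α′) `exists_norm_truncation_le_level_cm_three_uniform` ∘ ★ `hMfU_level_cm_three`)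
  obtain ⟨r, hr0, -, M₀, hM₀⟩ := exists_norm_truncation_le_level_cm_three_uniform L ν h𝓕 h𝓕c hφM hφB hT
    (hMfU_level_cm_three L ν h𝓕 h𝓕c hφc hφM hφN hφB hT) hz
  have hKcS : Metric.closedBall z r ∈ 𝓝[{z' : ℂ | 2 < z'.re ∧ z'.re < z.re}] z := mem_nhdsWithin_of_mem_nhds (Metric.closedBall_mem_nhds z hr0)
  -- Borel descent of every `Λ^T E(φ, z′)`, `Re z′ > 2`
  have hmeas : ∀ z' : ℂ, 2 < z'.re →
      AEStronglyMeasurable ((quasiSplit (↥(maximalRealSubfield L)) L (IsCMField.complexConj L) 3).quotFun (truncation ν 𝓕 T (eisensteinSeriesU (flatSectionU φ z')))) μ :=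
    fun z' hz' => (measurable_quotFun_of_measurable (measurable_truncation_eisensteinSeriesU_flatSectionU_cm_three' L ν 𝓕 hT hz' hφc hφM)
      (truncation_eisensteinSeriesU_flatSectionU_arithmeticSubgroup_mul ν h𝓕 T hφB z')).aestronglyMeasurable
  have key := integral_quotFun_mul_conj_eq_of_closure (quasiSplit (↥(maximalRealSubfield L)) L (IsCMField.complexConj L) 3) μ (mem_closure_subtube hz)
    (Λ' := fun z' : ℂ => truncation ν 𝓕 T (eisensteinSeriesU (flatSectionU φ z')))
    (hmeas z hz) (hM₀ z (Metric.mem_closedBall_self hr0.le))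
    (eventually_nhdsWithin_of_forall fun z' hz' => hmeas z' hz'.1)
    (by filter_upwards [hKcS] with z' hz'; exact hM₀ z' hz')
    hcont hR fun z' hz' => hrel z' hz'.1 hz'.2
  rw [integral_mul_conj_self_eq] at key
  exact key

/-- **THE DIAGONAL NORM FORMULA WITH `hcont` DISCHARGED, FREE EDITION** (★ `integral_normSq_truncation_eq_cm_three` minus `hdec`; ★ (R6g-c) for `hcont`).
[cite: Arthur1980TraceFormulaII, §4] [cite: MoeglinWaldspurger1995, IV.2.3] -/
theorem integral_normSq_truncation_eq_cm_three_free
    (ν : Measure (adelicUnipotent (↥(maximalRealSubfield L)) L (IsCMField.complexConj L) 3)) [ν.IsHaarMeasure]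
    {𝓕 : Set (adelicUnipotent (↥(maximalRealSubfield L)) L (IsCMField.complexConj L) 3)}
    (h𝓕 : IsFundamentalDomain (rationalUnipotent (↥(maximalRealSubfield L)) L (IsCMField.complexConj L) 3) 𝓕 ν) (h𝓕c : IsCompact (closure 𝓕)) (h𝓕top : ν 𝓕 ≠ ∞) {T : ℝ≥0} (hT : 1 ≤ T)
    {z : ℂ} (hz : 2 < z.re)
    {φ : (quasiSplit (↥(maximalRealSubfield L)) L (IsCMField.complexConj L) 3).Adelic → ℂ} (hφc : Continuous φ) {M : ℝ} (hφM : ∀ x, ‖φ x‖ ≤ M)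
    (hφB : ∀ b ∈ borelU ((IsCMField.complexConj L : L ≃ₐ[↥(maximalRealSubfield L)] L) : L →+* L) ((StdForm.antidiagonal 3).over L),
      ∀ x : (quasiSplit (↥(maximalRealSubfield L)) L (IsCMField.complexConj L) 3).Adelic,
        φ ((quasiSplit (↥(maximalRealSubfield L)) L (IsCMField.complexConj L) 3).toAdelic b * x) = φ x)
    (hφN : ∀ (u : ↥(adelicUnipotent (↥(maximalRealSubfield L)) L (IsCMField.complexConj L) 3)) (x : (quasiSplit (↥(maximalRealSubfield L)) L (IsCMField.complexConj L) 3).Adelic), φ ((u : (quasiSplit (↥(maximalRealSubfield L)) L (IsCMField.complexConj L) 3).Adelic) * x) = φ x)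
    (μ : Measure (quasiSplit (↥(maximalRealSubfield L)) L (IsCMField.complexConj L) 3).automorphicQuotient) [IsFiniteMeasure μ]
    {R : ℂ → ℂ} (hR : ContinuousWithinAt R {z' : ℂ | 2 < z'.re ∧ z'.re < z.re} z)
    (hrel : ∀ z' : ℂ, 2 < z'.re → z'.re < z.re →
      ∫ x, (quasiSplit (↥(maximalRealSubfield L)) L (IsCMField.complexConj L) 3).quotFun (truncation ν 𝓕 T (eisensteinSeriesU (flatSectionU φ z))) x *
          conj ((quasiSplit (↥(maximalRealSubfield L)) L (IsCMField.complexConj L) 3).quotFun (truncation ν 𝓕 T (eisensteinSeriesU (flatSectionU φ z'))) x) ∂μ = R z') :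
    ((∫ x, ‖(quasiSplit (↥(maximalRealSubfield L)) L (IsCMField.complexConj L) 3).quotFun (truncation ν 𝓕 T (eisensteinSeriesU (flatSectionU φ z))) x‖ ^ 2 ∂μ : ℝ) : ℂ) = R z :=
  maassSelberg_diagonal_flatSectionU_cm_three_free L ν h𝓕 h𝓕c hT hz hφc hφM hφB hφN μ
    (fun g => continuousWithinAt_truncation_eisensteinSeriesU_flatSectionU_subtube_cm_three L ν h𝓕top hT hφc hφM hφB hz g) hR hrel

/-- **POLE CONTROL AT THE CM PAIR ON `{Re z > 2}`, FREE EDITION** (★ `poleControl_diag_flatSectionU_cm_three` minus `hdec`): from the relation of record on the sub-tube, the continuity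
of its right side at `z`, and the diagonal four-term shape with `B₁ = a > 0`, `B₃ = conj W`, `B₄ = b ≥ 0`, `‖W‖² ≤ ab`, `Im z ≠ 0`: the three bounds on `b` (`√b ≤ …∕|Im z|`, box form,
`b ≤ C∕y²`). [cite: MoeglinWaldspurger1995, IV.3.12 (a)] [cite: Garrett2018, §1.12] [cite: Arthur1980TraceFormulaII, §4] -/
theorem poleControl_diag_flatSectionU_cm_three_free
    (ν : Measure (adelicUnipotent (↥(maximalRealSubfield L)) L (IsCMField.complexConj L) 3)) [ν.IsHaarMeasure]
    {𝓕 : Set (adelicUnipotent (↥(maximalRealSubfield L)) L (IsCMField.complexConj L) 3)}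
    (h𝓕 : IsFundamentalDomain (rationalUnipotent (↥(maximalRealSubfield L)) L (IsCMField.complexConj L) 3) 𝓕 ν) (h𝓕c : IsCompact (closure 𝓕)) (h𝓕top : ν 𝓕 ≠ ∞) {T : ℝ≥0} (hT : 1 ≤ T)
    {z : ℂ} (hz : 2 < z.re) (hy : z.im ≠ 0)
    {φ : (quasiSplit (↥(maximalRealSubfield L)) L (IsCMField.complexConj L) 3).Adelic → ℂ} (hφc : Continuous φ) {M : ℝ} (hφM : ∀ x, ‖φ x‖ ≤ M)
    (hφB : ∀ b ∈ borelU ((IsCMField.complexConj L : L ≃ₐ[↥(maximalRealSubfield L)] L) : L →+* L) ((StdForm.antidiagonal 3).over L),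
      ∀ x : (quasiSplit (↥(maximalRealSubfield L)) L (IsCMField.complexConj L) 3).Adelic,
        φ ((quasiSplit (↥(maximalRealSubfield L)) L (IsCMField.complexConj L) 3).toAdelic b * x) = φ x)
    (hφN : ∀ (u : ↥(adelicUnipotent (↥(maximalRealSubfield L)) L (IsCMField.complexConj L) 3)) (x : (quasiSplit (↥(maximalRealSubfield L)) L (IsCMField.complexConj L) 3).Adelic), φ ((u : (quasiSplit (↥(maximalRealSubfield L)) L (IsCMField.complexConj L) 3).Adelic) * x) = φ x)
    (μ : Measure (quasiSplit (↥(maximalRealSubfield L)) L (IsCMField.complexConj L) 3).automorphicQuotient) [IsFiniteMeasure μ]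
    {R : ℂ → ℂ} (hR : ContinuousWithinAt R {z' : ℂ | 2 < z'.re ∧ z'.re < z.re} z)
    (hrel : ∀ z' : ℂ, 2 < z'.re → z'.re < z.re →
      ∫ x, (quasiSplit (↥(maximalRealSubfield L)) L (IsCMField.complexConj L) 3).quotFun (truncation ν 𝓕 T (eisensteinSeriesU (flatSectionU φ z))) x *
          conj ((quasiSplit (↥(maximalRealSubfield L)) L (IsCMField.complexConj L) 3).quotFun (truncation ν 𝓕 T (eisensteinSeriesU (flatSectionU φ z'))) x) ∂μ = R z')
    -- the diagonal SHAPE of the right side (★ ED. 5∕6 currency) and the bracket facts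
    {cμ K a b : ℝ} (hcμ : 0 < cμ) (hK : 0 < K) (ha : 0 < a) (hb : 0 ≤ b) {W B₁ B₃ B₄ : ℂ}
    (hB₁ : B₁ = (a : ℂ)) (hB₃ : B₃ = conj W) (hB₄ : B₄ = (b : ℂ)) (hW : ‖W‖ ^ 2 ≤ a * b)
    (hRz : R z = (cμ : ℂ) * ((K : ℂ) *
      (((T : ℝ) : ℂ) ^ (z + conj z - 2) / (z + conj z - 2) * B₁ + ((T : ℝ) : ℂ) ^ (z - conj z) / (z - conj z) * W
        - ((T : ℝ) : ℂ) ^ (-(z - conj z)) / (z - conj z) * B₃ - ((T : ℝ) : ℂ) ^ (-(z + conj z - 2)) / (z + conj z - 2) * B₄))) :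
    Real.sqrt b ≤ (z.re - 1) * (T : ℝ) ^ (2 * (z.re - 1)) * Real.sqrt a / |z.im| +
        Real.sqrt ((z.re - 1) ^ 2 * (T : ℝ) ^ (4 * (z.re - 1)) * a / z.im ^ 2 + a * (T : ℝ) ^ (4 * (z.re - 1))) ∧
      (∀ {x₁ x₂ η : ℝ}, 0 < x₁ → z.re - 1 ∈ Set.Icc x₁ x₂ → 0 < η → η ≤ |z.im| →
        b ≤ (x₂ * (T : ℝ) ^ (2 * x₂) * Real.sqrt a / η + Real.sqrt (x₂ ^ 2 * (T : ℝ) ^ (4 * x₂) * a / η ^ 2 + a * (T : ℝ) ^ (4 * x₂))) ^ 2) ∧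
      (|z.im| ≤ 1 → b ≤ ((z.re - 1) * (T : ℝ) ^ (2 * (z.re - 1)) * Real.sqrt a +
        Real.sqrt ((z.re - 1) ^ 2 * (T : ℝ) ^ (4 * (z.re - 1)) * a + a * (T : ℝ) ^ (4 * (z.re - 1)))) ^ 2 / z.im ^ 2) := by
  have hNeq := integral_normSq_truncation_eq_cm_three_free L ν h𝓕 h𝓕c h𝓕top hT hz hφc hφM hφB hφN μ hR hrel
  rw [hRz] at hNeq
  exact poleControl_of_fourTerm_conj (integral_nonneg fun x => sq_nonneg _) hcμ hK (by exact_mod_cast hT) (by linarith) ha hb hy (add_conj_sub_two_eq z) hB₁ hB₃ hB₄ hW hNeq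

variable [MeasurableSpace (AdeleRing (𝓞 L) L)ˣ] [BorelSpace (AdeleRing (𝓞 L) L)ˣ]

/-- **POLE CONTROL ON THE GODEMENT HALF-PLANE FOR FLAT SECTIONS OF `U(J₃)` AT THE CM PAIR — FREE EDITION of ★ `poleControl_flatSectionU_cm_three_final`**: BOTH decay letters
(`hdec′` pointwise on the sub-tube, `hdecU` locally uniform at `z`) DELETED — `hrel` now comes from ★ ED. 3 `maassSelberg_flatSectionU_cm_three_final_free` (p863150) and the uniform sup
bound from ★ (α′) ∘ ★ `hMfU_level_cm_three` (p863443) — NOTHING added.  NAMED INPUTS EXACTLY: the `K_U`-average data `Ξ₁, Ξ₂(·), Ξ₃, Ξ₄(·)` with their torus identities, the bracket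
continuity `hB₂ hB₄`, and the diagonal identification `h₁ h₃ h₄ hW` (bracket-level; for `(χ₁, χ₂)`-pair sections ★ p863103 `xi_package_cross` supplies the `Ξ`'s).  Conclusion verbatim
(IV.3.12 (a)'s analytic core on `{Re z > 2}`, `Im z ≠ 0`). [cite: MoeglinWaldspurger1995, IV.2.3, IV.3.12] [cite: Arthur1980TraceFormulaII, §4] [cite: Garrett2018, §1.12, §11.3] -/
theorem poleControl_flatSectionU_cm_three_final_free
    (μ : Measure (quasiSplit (↥(maximalRealSubfield L)) L (IsCMField.complexConj L) 3).automorphicQuotient) [(quasiSplit (↥(maximalRealSubfield L)) L (IsCMField.complexConj L) 3).IsAutomorphicMeasure μ]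
    (νG : Measure (quasiSplit (↥(maximalRealSubfield L)) L (IsCMField.complexConj L) 3).Adelic) [νG.IsHaarMeasure] [νG.IsInvInvariant]
    (μK : Measure ((standardMaximalCompactGL 3 L).comap (adelicVal (↥(maximalRealSubfield L)) L (IsCMField.complexConj L) 3 ((StdForm.antidiagonal 3).over L)) : Subgroup (quasiSplit (↥(maximalRealSubfield L)) L (IsCMField.complexConj L) 3).Adelic))
    [μK.IsHaarMeasure]
    (νI : Measure (AdeleRing (𝓞 L) L)ˣ) [νI.IsHaarMeasure]
    {𝓕I : Set (AdeleRing (𝓞 L) L)ˣ} (h𝓕I : IsIdeleClassDomain L 𝓕I)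
    (ν : Measure ↥(adelicUnipotent (↥(maximalRealSubfield L)) L (IsCMField.complexConj L) 3)) [ν.IsHaarMeasure] [ν.IsInvInvariant]
    {𝓕 : Set ↥(adelicUnipotent (↥(maximalRealSubfield L)) L (IsCMField.complexConj L) 3)} (h𝓕N : IsFundamentalDomain ↥(rationalUnipotent (↥(maximalRealSubfield L)) L (IsCMField.complexConj L) 3) 𝓕 ν) (h𝓕1 : ν 𝓕 = 1) (h𝓕c : IsCompact (closure 𝓕))
    {β : (quasiSplit (↥(maximalRealSubfield L)) L (IsCMField.complexConj L) 3).Adelic → ℝ≥0∞} (hβ : IsCoveringWeight ((arithmeticBorel (↥(maximalRealSubfield L)) L (IsCMField.complexConj L) 3).map (quasiSplit (↥(maximalRealSubfield L)) L (IsCMField.complexConj L) 3).arithmeticSubgroup.subtype) β)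
    {T : ℝ≥0} (hT : 1 ≤ T)
    {φ : (quasiSplit (↥(maximalRealSubfield L)) L (IsCMField.complexConj L) 3).Adelic → ℂ} (hφc : Continuous φ)
    (hφN : ∀ (n : unipotentInBorel (↥(maximalRealSubfield L)) L (IsCMField.complexConj L) 3) (y : (quasiSplit (↥(maximalRealSubfield L)) L (IsCMField.complexConj L) 3).Adelic), φ (((n : borelAdelic (↥(maximalRealSubfield L)) L (IsCMField.complexConj L) 3) : (quasiSplit (↥(maximalRealSubfield L)) L (IsCMField.complexConj L) 3).Adelic) * y) = φ y)
    (hφB : ∀ b ∈ arithmeticBorel (↥(maximalRealSubfield L)) L (IsCMField.complexConj L) 3, ∀ y : (quasiSplit (↥(maximalRealSubfield L)) L (IsCMField.complexConj L) 3).Adelic, φ ((b : (quasiSplit (↥(maximalRealSubfield L)) L (IsCMField.complexConj L) 3).Adelic) * y) = φ y)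
    {Cφ : ℝ} (hφC : ∀ x, ‖φ x‖ ≤ Cφ)
    {z : ℂ} (hz : 2 < z.re) (hy : z.im ≠ 0)
    -- the `K_U`-average data: CONSTANT `Ξ₁` (`φ·conj φ`), `Ξ₃` (`φ̃_z·conj φ`); FAMILIES `Ξ₂ z′` (`φ·conj φ̃_{z′}`), `Ξ₄ z′` (`φ̃_z·conj φ̃_{z′}`) («VAC-B»: functions of `z′`)
    {Ξ₁ Ξ₃ : (AdeleRing (𝓞 L) L)ˣ → ℂ} {Ξ₂ Ξ₄ : ℂ → (AdeleRing (𝓞 L) L)ˣ → ℂ}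
    (hΞ₁m : Measurable Ξ₁) {CΞ₁ : ℝ} (hΞ₁C : ∀ x, ‖Ξ₁ x‖ ≤ CΞ₁) (hΞ₁K : ∀ k ∈ GaloisRepresentations.principalIdeles L, ∀ x, Ξ₁ (k * x) = Ξ₁ x)
    (hΞ₁M : ∀ (r : ℝ≥0ˣ) (x : (AdeleRing (𝓞 L) L)ˣ), Ξ₁ (posRealIdele L r * x) = Ξ₁ x)
    (hΞ₁ : ∀ t : torusInBorel (↥(maximalRealSubfield L)) L (IsCMField.complexConj L) 3, ∫ k, φ (((t : borelAdelic (↥(maximalRealSubfield L)) L (IsCMField.complexConj L) 3) : (quasiSplit (↥(maximalRealSubfield L)) L (IsCMField.complexConj L) 3).Adelic) * (k : (quasiSplit (↥(maximalRealSubfield L)) L (IsCMField.complexConj L) 3).Adelic)) * conj (φ (((t : borelAdelic (↥(maximalRealSubfield L)) L (IsCMField.complexConj L) 3) : (quasiSplit (↥(maximalRealSubfield L)) L (IsCMField.complexConj L) 3).Adelic) * (k : (quasiSplit (↥(maximalRealSubfield L)) L (IsCMField.complexConj L) 3).Adelic))) ∂μK = Ξ₁ (diagUnit (t : borelAdelic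 (↥(maximalRealSubfield L)) L (IsCMField.complexConj L) 3).2 0))
    (hΞ₂m : ∀ z' : ℂ, Measurable (Ξ₂ z')) {CΞ₂ : ℂ → ℝ} (hΞ₂C : ∀ (z' : ℂ) x, ‖Ξ₂ z' x‖ ≤ CΞ₂ z') (hΞ₂K : ∀ z' : ℂ, ∀ k ∈ GaloisRepresentations.principalIdeles L, ∀ x, Ξ₂ z' (k * x) = Ξ₂ z' x)
    (hΞ₂M : ∀ (z' : ℂ) (r : ℝ≥0ˣ) (x : (AdeleRing (𝓞 L) L)ˣ), Ξ₂ z' (posRealIdele L r * x) = Ξ₂ z' x)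
    (hΞ₂ : ∀ (z' : ℂ) (t : torusInBorel (↥(maximalRealSubfield L)) L (IsCMField.complexConj L) 3), ∫ k, φ (((t : borelAdelic (↥(maximalRealSubfield L)) L (IsCMField.complexConj L) 3) : (quasiSplit (↥(maximalRealSubfield L)) L (IsCMField.complexConj L) 3).Adelic) * (k : (quasiSplit (↥(maximalRealSubfield L)) L (IsCMField.complexConj L) 3).Adelic)) * conj ((fun g : (quasiSplit (↥(maximalRealSubfield L)) L (IsCMField.complexConj L) 3).Adelic => (∫ v : ↥(adelicUnipotent (↥(maximalRealSubfield L)) L (IsCMField.complexConj L) 3), flatSectionU φ z' ((quasiSplit (↥(maximalRealSubfield L)) L (IsCMField.complexConj L) 3).toAdelic (weylLongU ((IsCMField.complexConj L : L ≃ₐ[↥(maximalRealSubfield L)] L) : L →+* L) (rfl : (StdForm.antidiagonal 3).over L = (StdForm.antidiagonal 3).over L)) * ((v : (quasiSplit (↥(maximalRealSubfield L)) L (IsCMField.complexConj L) 3).Adelic) * g)) ∂ν) * ((borelHeight g : ℝ) : ℂ) ^ (z' - 2)) (((t : borelAdelic (↥(maximalRealSubfield L)) L (IsCMField.complexConj L)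 3) : (quasiSplit (↥(maximalRealSubfield L)) L (IsCMField.complexConj L) 3).Adelic) * (k : (quasiSplit (↥(maximalRealSubfield L)) L (IsCMField.complexConj L) 3).Adelic))) ∂μK = Ξ₂ z' (diagUnit (t : borelAdelic (↥(maximalRealSubfield L)) L (IsCMField.complexConj L) 3).2 0))
    (hΞ₃m : Measurable Ξ₃) {CΞ₃ : ℝ} (hΞ₃C : ∀ x, ‖Ξ₃ x‖ ≤ CΞ₃) (hΞ₃K : ∀ k ∈ GaloisRepresentations.principalIdeles L, ∀ x, Ξ₃ (k * x) = Ξ₃ x)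
    (hΞ₃M : ∀ (r : ℝ≥0ˣ) (x : (AdeleRing (𝓞 L) L)ˣ), Ξ₃ (posRealIdele L r * x) = Ξ₃ x)
    (hΞ₃ : ∀ t : torusInBorel (↥(maximalRealSubfield L)) L (IsCMField.complexConj L) 3, ∫ k, (fun g : (quasiSplit (↥(maximalRealSubfield L)) L (IsCMField.complexConj L) 3).Adelic => (∫ v : ↥(adelicUnipotent (↥(maximalRealSubfield L)) L (IsCMField.complexConj L) 3), flatSectionU φ z ((quasiSplit (↥(maximalRealSubfield L)) L (IsCMField.complexConj L) 3).toAdelic (weylLongU ((IsCMField.complexConj L : L ≃ₐ[↥(maximalRealSubfield L)] L) : L →+* L) (rfl : (StdForm.antidiagonal 3).over L = (StdForm.antidiagonal 3).over L)) * ((v : (quasiSplit (↥(maximalRealSubfield L)) L (IsCMField.complexConj L) 3).Adelic) * g)) ∂ν) * ((borelHeight g : ℝ) : ℂ) ^ (z - 2)) (((t : borelAdelic (↥(maximalRealSubfield L)) L (IsCMField.complexConj L) 3) : (quasiSplit (↥(maximalRealSubfield L)) L (IsCMField.complexConj L) 3).Adelic) * (k : (quasiSplit (↥(maximalRealSubfield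 L)) L (IsCMField.complexConj L) 3).Adelic)) * conj (φ (((t : borelAdelic (↥(maximalRealSubfield L)) L (IsCMField.complexConj L) 3) : (quasiSplit (↥(maximalRealSubfield L)) L (IsCMField.complexConj L) 3).Adelic) * (k : (quasiSplit (↥(maximalRealSubfield L)) L (IsCMField.complexConj L) 3).Adelic))) ∂μK = Ξ₃ (diagUnit (t : borelAdelic (↥(maximalRealSubfield L)) L (IsCMField.complexConj L) 3).2 0))
    (hΞ₄m : ∀ z' : ℂ, Measurable (Ξ₄ z')) {CΞ₄ : ℂ → ℝ} (hΞ₄C : ∀ (z' : ℂ) x, ‖Ξ₄ z' x‖ ≤ CΞ₄ z') (hΞ₄K : ∀ z' : ℂ, ∀ k ∈ GaloisRepresentations.principalIdeles L, ∀ x, Ξ₄ z' (k * x) = Ξ₄ z' x)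
    (hΞ₄M : ∀ (z' : ℂ) (r : ℝ≥0ˣ) (x : (AdeleRing (𝓞 L) L)ˣ), Ξ₄ z' (posRealIdele L r * x) = Ξ₄ z' x)
    (hΞ₄ : ∀ (z' : ℂ) (t : torusInBorel (↥(maximalRealSubfield L)) L (IsCMField.complexConj L) 3), ∫ k, (fun g : (quasiSplit (↥(maximalRealSubfield L)) L (IsCMField.complexConj L) 3).Adelic => (∫ v : ↥(adelicUnipotent (↥(maximalRealSubfield L)) L (IsCMField.complexConj L) 3), flatSectionU φ z ((quasiSplit (↥(maximalRealSubfield L)) L (IsCMField.complexConj L) 3).toAdelic (weylLongU ((IsCMField.complexConj L : L ≃ₐ[↥(maximalRealSubfield L)] L) : L →+* L) (rfl : (StdForm.antidiagonal 3).over L = (StdForm.antidiagonal 3).over L)) * ((v : (quasiSplit (↥(maximalRealSubfield L)) L (IsCMField.complexConj L) 3).Adelic) * g)) ∂ν) * ((borelHeight g : ℝ) : ℂ) ^ (z - 2)) (((t : borelAdelic (↥(maximalRealSubfield L)) L (IsCMField.complexConj L) 3) : (quasiSplit (↥(maximalRealSubfield L)) L (IsCMField.complexConj L) 3).Adelic)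 * (k : (quasiSplit (↥(maximalRealSubfield L)) L (IsCMField.complexConj L) 3).Adelic)) * conj ((fun g : (quasiSplit (↥(maximalRealSubfield L)) L (IsCMField.complexConj L) 3).Adelic => (∫ v : ↥(adelicUnipotent (↥(maximalRealSubfield L)) L (IsCMField.complexConj L) 3), flatSectionU φ z' ((quasiSplit (↥(maximalRealSubfield L)) L (IsCMField.complexConj L) 3).toAdelic (weylLongU ((IsCMField.complexConj L : L ≃ₐ[↥(maximalRealSubfield L)] L) : L →+* L) (rfl : (StdForm.antidiagonal 3).over L = (StdForm.antidiagonal 3).over L)) * ((v : (quasiSplit (↥(maximalRealSubfield L)) L (IsCMField.complexConj L) 3).Adelic) * g)) ∂ν) * ((borelHeight g : ℝ) : ℂ) ^ (z' - 2)) (((t : borelAdelic (↥(maximalRealSubfield L)) L (IsCMField.complexConj L) 3) : (quasiSplit (↥(maximalRealSubfield L)) L (IsCMField.complexConj L) 3).Adelic) * (k : (quasiSplit (↥(maximalRealSubfield L)) L (IsCMField.complexConj L) 3).Adelic))) ∂μK = Ξ₄ z' (diagUnit (t : borelAdelic (↥(maximalRealSubfield L)) L (IsCMField.complexConj L) 3).2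 0))
    -- bracket continuity at `z` from inside the sub-tube ((R6j) layers ★ p858065 pay it once the `Ξᵢ^{(z′)}` are concrete) and the diagonal identification (★ p858038 Cauchy–Schwarz)
    (hB₂ : ContinuousWithinAt (fun z' : ℂ => (∫ x in {x : (AdeleRing (𝓞 L) L)ˣ | (IdeleClassGroup.ideleNorm L x : ℝ) ≤ 1} ∩ 𝓕I, ((IdeleClassGroup.ideleNorm L x : ℝ) : ℂ) * (Ξ₂ z') x ∂νI)) {z' : ℂ | 2 < z'.re ∧ z'.re < z.re} z)
    (hB₄ : ContinuousWithinAt (fun z' : ℂ => (∫ x in {x : (AdeleRing (𝓞 L) L)ˣ | (IdeleClassGroup.ideleNorm L x : ℝ) ≤ 1} ∩ 𝓕I, ((IdeleClassGroup.ideleNorm L x : ℝ) : ℂ) * (Ξ₄ z') x ∂νI)) {z' : ℂ | 2 < z'.re ∧ z'.re < z.re} z)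
    {a b : ℝ} (ha : 0 < a) (hb : 0 ≤ b) (h₁ : (∫ x in {x : (AdeleRing (𝓞 L) L)ˣ | (IdeleClassGroup.ideleNorm L x : ℝ) ≤ 1} ∩ 𝓕I, ((IdeleClassGroup.ideleNorm L x : ℝ) : ℂ) * Ξ₁ x ∂νI) = (a : ℂ)) (h₃ : (∫ x in {x : (AdeleRing (𝓞 L) L)ˣ | (IdeleClassGroup.ideleNorm L x : ℝ) ≤ 1} ∩ 𝓕I, ((IdeleClassGroup.ideleNorm L x : ℝ) : ℂ) * Ξ₃ x ∂νI) = conj (∫ x in {x : (AdeleRing (𝓞 L) L)ˣ | (IdeleClassGroup.ideleNorm L x : ℝ) ≤ 1} ∩ 𝓕I, ((IdeleClassGroup.ideleNorm L x : ℝ) : ℂ) * (Ξ₂ z) x ∂νI))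
    (h₄ : (∫ x in {x : (AdeleRing (𝓞 L) L)ˣ | (IdeleClassGroup.ideleNorm L x : ℝ) ≤ 1} ∩ 𝓕I, ((IdeleClassGroup.ideleNorm L x : ℝ) : ℂ) * (Ξ₄ z) x ∂νI) = (b : ℂ)) (hW : ‖(∫ x in {x : (AdeleRing (𝓞 L) L)ˣ | (IdeleClassGroup.ideleNorm L x : ℝ) ≤ 1} ∩ 𝓕I, ((IdeleClassGroup.ideleNorm L x : ℝ) : ℂ) * (Ξ₂ z) x ∂νI)‖ ^ 2 ≤ a * b) :
    Real.sqrt b ≤ (z.re - 1) * (T : ℝ) ^ (2 * (z.re - 1)) * Real.sqrt a / |z.im| +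
        Real.sqrt ((z.re - 1) ^ 2 * (T : ℝ) ^ (4 * (z.re - 1)) * a / z.im ^ 2 + a * (T : ℝ) ^ (4 * (z.re - 1))) ∧
      (∀ {x₁ x₂ η : ℝ}, 0 < x₁ → z.re - 1 ∈ Set.Icc x₁ x₂ → 0 < η → η ≤ |z.im| →
        b ≤ (x₂ * (T : ℝ) ^ (2 * x₂) * Real.sqrt a / η + Real.sqrt (x₂ ^ 2 * (T : ℝ) ^ (4 * x₂) * a / η ^ 2 + a * (T : ℝ) ^ (4 * x₂))) ^ 2) ∧
      (|z.im| ≤ 1 → b ≤ ((z.re - 1) * (T : ℝ) ^ (2 * (z.re - 1)) * Real.sqrt a +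
        Real.sqrt ((z.re - 1) ^ 2 * (T : ℝ) ^ (4 * (z.re - 1)) * a + a * (T : ℝ) ^ (4 * (z.re - 1)))) ^ 2 / z.im ^ 2) := by
  haveI := t2Space_adeleRing_of_numberField L
  obtain ⟨cμ, K, hcμ, hK, hfin'⟩ := maassSelberg_flatSectionU_cm_three_final_free L μ νG μK νI h𝓕I ν h𝓕N h𝓕1 h𝓕c
  have hT0 : (0 : ℝ) < (T : ℝ) := lt_of_lt_of_le one_pos (by exact_mod_cast hT)
  -- the right-hand side of record as a FUNCTION of `z′`
  set R : ℂ → ℂ := fun z' => (cμ : ℂ) * ((K : ℂ) *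
    ((((T : ℝ) : ℂ) ^ (z + conj z' - 2) / (z + conj z' - 2)) * (∫ x in {x : (AdeleRing (𝓞 L) L)ˣ | (IdeleClassGroup.ideleNorm L x : ℝ) ≤ 1} ∩ 𝓕I, ((IdeleClassGroup.ideleNorm L x : ℝ) : ℂ) * Ξ₁ x ∂νI)
      + (((T : ℝ) : ℂ) ^ (z - conj z') / (z - conj z')) * (∫ x in {x : (AdeleRing (𝓞 L) L)ˣ | (IdeleClassGroup.ideleNorm L x : ℝ) ≤ 1} ∩ 𝓕I, ((IdeleClassGroup.ideleNorm L x : ℝ) : ℂ) * (Ξ₂ z') x ∂νI)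
      - (((T : ℝ) : ℂ) ^ (-(z - conj z')) / (z - conj z')) * (∫ x in {x : (AdeleRing (𝓞 L) L)ˣ | (IdeleClassGroup.ideleNorm L x : ℝ) ≤ 1} ∩ 𝓕I, ((IdeleClassGroup.ideleNorm L x : ℝ) : ℂ) * Ξ₃ x ∂νI)
      - (((T : ℝ) : ℂ) ^ (-(z + conj z' - 2)) / (z + conj z' - 2)) * (∫ x in {x : (AdeleRing (𝓞 L) L)ˣ | (IdeleClassGroup.ideleNorm L x : ℝ) ≤ 1} ∩ 𝓕I, ((IdeleClassGroup.ideleNorm L x : ℝ) : ℂ) * (Ξ₄ z') x ∂νI))) with hRdef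
  -- `hrel` DERIVED per `z′` from ★ CM-FINAL′ (`φ′ := φ`)
  have hrel : ∀ z' : ℂ, 2 < z'.re → z'.re < z.re →
      ∫ x, (quasiSplit (↥(maximalRealSubfield L)) L (IsCMField.complexConj L) 3).quotFun (truncation ν 𝓕 T (eisensteinSeriesU (flatSectionU φ z))) x * conj ((quasiSplit (↥(maximalRealSubfield L)) L (IsCMField.complexConj L) 3).quotFun (truncation ν 𝓕 T (eisensteinSeriesU (flatSectionU φ z'))) x) ∂μ = R z' := by
    intro z' hz' hzz'
    rw [hRdef]
    exact hfin' hβ hT hφc hφN hφB hφC hφc hφN hφB hφC hz' hzz' hΞ₁m hΞ₁C hΞ₁K hΞ₁M hΞ₁ (hΞ₂m z') (hΞ₂C z') (hΞ₂K z') (hΞ₂M z') (hΞ₂ z')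
      hΞ₃m hΞ₃C hΞ₃K hΞ₃M hΞ₃ (hΞ₄m z') (hΞ₄C z') (hΞ₄K z') (hΞ₄M z') (hΞ₄ z')
  -- `hR`: the right side is continuous at `z` from inside the sub-tube (§1 + `hB₂`, `hB₄`)
  have hs₁ : z + conj z - 2 ≠ 0 := by
    have hx : (0 : ℝ) < 2 * (z.re - 1) := by linarith
    rw [add_conj_sub_two_eq]; exact_mod_cast hx.ne'
  have hs₂ : z - conj z ≠ 0 := by
    rw [Complex.sub_conj]; exact mul_ne_zero (by exact_mod_cast (show (2 * z.im : ℝ) ≠ 0 from mul_ne_zero two_ne_zero hy)) Complex.I_ne_zero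
  have hR : ContinuousWithinAt R {z' : ℂ | 2 < z'.re ∧ z'.re < z.re} z := by
    rw [hRdef]; exact continuousWithinAt_fourTerm hT0 hs₁ hs₂ hB₂ hB₄
  have hRz : R z = (cμ : ℂ) * ((K : ℂ) *
    ((((T : ℝ) : ℂ) ^ (z + conj z - 2) / (z + conj z - 2)) * (∫ x in {x : (AdeleRing (𝓞 L) L)ˣ | (IdeleClassGroup.ideleNorm L x : ℝ) ≤ 1} ∩ 𝓕I, ((IdeleClassGroup.ideleNorm L x : ℝ) : ℂ) * Ξ₁ x ∂νI)
      + (((T : ℝ) : ℂ) ^ (z - conj z) / (z - conj z)) * (∫ x in {x : (AdeleRing (𝓞 L) L)ˣ | (IdeleClassGroup.ideleNorm L x : ℝ) ≤ 1} ∩ 𝓕I, ((IdeleClassGroup.ideleNorm L x : ℝ) : ℂ) * (Ξ₂ z) x ∂νI)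
      - (((T : ℝ) : ℂ) ^ (-(z - conj z)) / (z - conj z)) * (∫ x in {x : (AdeleRing (𝓞 L) L)ˣ | (IdeleClassGroup.ideleNorm L x : ℝ) ≤ 1} ∩ 𝓕I, ((IdeleClassGroup.ideleNorm L x : ℝ) : ℂ) * Ξ₃ x ∂νI)
      - (((T : ℝ) : ℂ) ^ (-(z + conj z - 2)) / (z + conj z - 2)) * (∫ x in {x : (AdeleRing (𝓞 L) L)ˣ | (IdeleClassGroup.ideleNorm L x : ℝ) ≤ 1} ∩ 𝓕I, ((IdeleClassGroup.ideleNorm L x : ℝ) : ℂ) * (Ξ₄ z) x ∂νI))) := by rw [hRdef]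
  have hφN' : ∀ (u : ↥(adelicUnipotent (↥(maximalRealSubfield L)) L (IsCMField.complexConj L) 3)) (x : (quasiSplit (↥(maximalRealSubfield L)) L (IsCMField.complexConj L) 3).Adelic), φ ((u : (quasiSplit (↥(maximalRealSubfield L)) L (IsCMField.complexConj L) 3).Adelic) * x) = φ x :=
    fun u x => hφN ⟨⟨(u : (quasiSplit (↥(maximalRealSubfield L)) L (IsCMField.complexConj L) 3).Adelic), adelicUnipotent_le_borelAdelic u.2⟩, (mem_unipotentInBorel_iff _).2 u.2⟩ x
  exact poleControl_diag_flatSectionU_cm_three_free L ν h𝓕N h𝓕c (by rw [h𝓕1]; exact ENNReal.one_ne_top) hT hz hy hφc hφC (forall_arithmeticBorel_iff.1 hφB) hφN' μ hR hrel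
    hcμ hK ha hb h₁ h₃ h₄ hW hRz

end Summit.HodgeConjecture.HodgeConjecture.Cruxes.H413.K2E1MaassSelbergPoleControlFreeCMThree

end
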